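import Literature.Topology.FourManifolds.FibrewiseMorseParam
import Mathlib.Algebra.Order.ToIntervalMod
import HarnessLib

/-!
# The fibrewise Morse lemma with a global adapted frame (Morse–Bott lemma along the zero section)

Topic `Literature/Topology/FourManifolds`, continuing `FibrewiseMorseChart.lean` /
`FibrewiseMorseParam.lean` (Hirsch, *Differential Topology*, Ch. 6 §1, proof of Thm. 1.1, run with
a parameter).  There the fibrewise Morse coordinates `y (p, u)` of a family `g : P × V → ℝ`
with critical zero section and nondegenerate fibre Hessian are produced LOCALLY, near one
parameter `p₀`: Hirsch's map `P(B)` is defined for bilinear forms `B` near the one reference form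
`B₀ = ½ H(p₀)`, and the fibre Hadamard form `B (p, 0) = ½ H(p)` moves away from `B₀` with `p`.
If the family of fibre Hessians admits a **global adapted frame** — `C^∞` invertible linear maps
`M p` with `½ H(p) (a, b) = B₀ (M p a, M p b)` for ALL `p` — then normalising the Hadamard form
by the frame, `B̂ (p, u) (a, b) = B (p, u) (M p⁻¹ a, M p⁻¹ b)`, gives `B̂ (p, 0) = B₀` for all
`p`, and Hirsch's argument runs at once on a neighbourhood of the WHOLE zero section
`P × {0}`: this is the Morse–Bott lemma for the nondegenerate critical manifold `P × {0}` of `g`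
(Banyaga–Hurtubise 2004, Thm. 2 — *"there is a tubular chart in which
`f = f(C) - y₁² - ⋯ - y_λ² + y_{λ+1}² + ⋯`"*) in the trivialised situation, the frame being the
reduction of the structure group of the normal bundle that such a chart requires.  Everything
here is **proved**; no definition, no named fact.

* `Literature.Analysis.Calculus.fibreHadamardSnd_translate` — the fibre Hadamard form of a
  family invariant under a translation `p ↦ p + c` of the parameter is invariant.
* `Splitting.exists_fibrewiseMorseCoords_of_frame` — **global fibrewise Morse coordinates from a
  global adapted frame**: `y`, `C^∞` on an open `W ⊇ P × {0}`, `y (p, 0) = 0`,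
  `∂ᵤ y (p, 0) = Λ ∘ M p` (invertible) for EVERY `p`, and `g = -(y₀² + ⋯ + y_{σ-1}²) + (y_σ² + ⋯)`
  on `W`, `σ` the index of `B₀`; moreover `W` and `y` are invariant under every translation of
  the parameter leaving `g`, `M`, `M⁻¹` invariant.
* `exists_ball_subset_of_forall_add` — a periodic open neighbourhood of `ℝ × {0}` in `ℝ × F`
  contains a uniform tube `ℝ × B(0, r)`; whence
  `Splitting.exists_periodic_fibrewiseMorseCoords_of_frame`, the **periodic version over `ℝ`**
  (parameter `t ∈ ℝ`, everything `T`-periodic): Morse coordinates on a uniform tube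
  `ℝ × B(0, r)`, `T`-periodic in `t` — the form used along a circle of nondegenerate critical
  points (e.g. the round circle of a broken Lefschetz fibration).

## References

* A. Banyaga, D. E. Hurtubise, *A proof of the Morse–Bott Lemma*, Expo. Math. 22 (2004),
  365–373, Thm. 2 and §3. [BanyagaHurtubise2004]
* M. W. Hirsch, *Differential Topology*, GTM 33 (1976), Ch. 6 §1, Thm. 1.1 and Lemma p. 145.
  [HirschDT1976]
-/

noncomputable section

set_option maxSynthPendingDepth 2

open Set Function Filter Module Metric
open scoped Topology ContDiff

/-! ### Translation invariance of the fibre Hadamard form -/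

namespace Literature.Analysis.Calculus

variable {E' E G : Type*} [NormedAddCommGroup E'] [NormedSpace ℝ E'] [NormedAddCommGroup E]
  [NormedSpace ℝ E] [NormedAddCommGroup G] [NormedSpace ℝ G]

/-- **A family invariant under a translation of the parameter has an invariant fibre Hadamard
form**: if `g (p + c, u) = g (p, u)` for all `(p, u)` then
`fibreHadamardSnd g (p + c, u) = fibreHadamardSnd g (p, u)` (the second derivative of
`g = g ∘ (· + (c, 0))` is `D²g ∘ (· + (c, 0))`, and the fibre Hadamard form is an integral of
it along the fibre ray). [folklore] -/
theorem fibreHadamardSnd_translate {g : E' × E → G} (c : E')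
    (hper : ∀ (p : E') (u : E), g (p + c, u) = g (p, u)) (p : E') (u : E) :
    fibreHadamardSnd g (p + c, u) = fibreHadamardSnd g (p, u) := by
  have hfun : g = fun x => g (x + (c, 0)) := by
    funext x
    obtain ⟨q, v⟩ := x
    simp only [Prod.mk_add_mk, add_zero, hper]
  have h1 : ∀ x, fderiv ℝ g x = fderiv ℝ g (x + (c, 0)) := fun x => by
    conv_lhs => rw [hfun]
    exact fderiv_comp_add_right (c, 0)
  have h2 : ∀ x, fderiv ℝ (fderiv ℝ g) x = fderiv ℝ (fderiv ℝ g) (x + (c, 0)) := fun x => by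
    have hf1 : fderiv ℝ g = fun x => fderiv ℝ g (x + (c, 0)) := funext h1
    conv_lhs => rw [hf1]
    exact fderiv_comp_add_right (c, 0)
  have hint : hadamardSnd₂ g (p + c, u) = hadamardSnd₂ g (p, u) := by
    simp only [hadamardSnd₂]
    congr 1
    funext s
    rw [h2 (p, s • u), Prod.mk_add_mk, add_zero]
  ext a b
  rw [fibreHadamardSnd_apply, fibreHadamardSnd_apply, hint]

end Literature.Analysis.Calculus

namespace Literature.Topology.FourManifolds

/-! ### A periodic neighbourhood of the zero section contains a uniform tube -/

/-- **A periodic open neighbourhood of `ℝ × {0}` contains a uniform tube.**  If `W ⊆ ℝ × F` is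
open, contains `(t, 0)` for every `t`, and is invariant under `t ↦ t + T` (`T > 0`), then
`ℝ × B(0, r) ⊆ W` for some `r > 0` (tube lemma over the compact period `[0, T]`, then
periodicity). [folklore] -/
theorem exists_ball_subset_of_forall_add {F : Type*} [SeminormedAddCommGroup F]
    {W : Set (ℝ × F)} (hWo : IsOpen W) (hW0 : ∀ t : ℝ, ((t, (0 : F)) : ℝ × F) ∈ W) {T : ℝ}
    (hT : 0 < T) (hper : ∀ (t : ℝ) (u : F), ((t, u) : ℝ × F) ∈ W → ((t + T, u) : ℝ × F) ∈ W)
    (hper' : ∀ (t : ℝ) (u : F), ((t, u) : ℝ × F) ∈ W → ((t - T, u) : ℝ × F) ∈ W) :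
    ∃ r > 0, ∀ (t : ℝ) (u : F), u ∈ ball (0 : F) r → ((t, u) : ℝ × F) ∈ W := by
  -- a tube over one period
  have hsub : Icc (0 : ℝ) T ×ˢ ({0} : Set F) ⊆ W := by
    rintro ⟨t, u⟩ ⟨-, hu⟩
    rw [mem_singleton_iff] at hu
    subst hu
    exact hW0 t
  obtain ⟨U, V, hU, hV, hIU, h0V, hUV⟩ :=
    generalized_tube_lemma isCompact_Icc isCompact_singleton hWo hsub
  obtain ⟨r, hr, hball⟩ := Metric.isOpen_iff.1 hV 0 (h0V rfl)
  refine ⟨r, hr, fun t u hu => ?_⟩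
  -- reduce `t` modulo `T` into `[0, T)`
  have hin : ∀ s ∈ Ico (0 : ℝ) T, ((s, u) : ℝ × F) ∈ W := fun s hs =>
    hUV ⟨hIU (Ico_subset_Icc_self hs), hball hu⟩
  have hshift : ∀ (n : ℤ) (s : ℝ), ((s, u) : ℝ × F) ∈ W → ((s + n • T, u) : ℝ × F) ∈ W := by
    intro n
    induction n using Int.induction_on with
    | zero => intro s hs; simpa using hs
    | succ n ih =>
      intro s hs
      have := hper _ u (ih s hs)
      rwa [add_assoc, ← add_one_zsmul] at this
    | pred n ih =>
      intro s hs
      have := hper' _ u (ih s hs)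
      have e : (-(n : ℤ) - 1) • T = -(n : ℤ) • T - T := by rw [sub_smul, one_smul]
      rw [e]
      rwa [add_sub_assoc] at this
  have hmod : toIcoMod hT 0 t ∈ Ico (0 : ℝ) T := by
    simpa using toIcoMod_mem_Ico hT 0 t
  have ht : toIcoMod hT 0 t + toIcoDiv hT 0 t • T = t := by
    rw [toIcoMod, sub_add_cancel]
  have := hshift (toIcoDiv hT 0 t) (toIcoMod hT 0 t) (hin _ hmod)
  rwa [ht] at this

namespace Splitting

variable {P : Type*} [NormedAddCommGroup P] [NormedSpace ℝ P] [FiniteDimensional ℝ P]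
  {V : Type*} [NormedAddCommGroup V] [NormedSpace ℝ V] [FiniteDimensional ℝ V] {n : ℕ}

/-! ### Global fibrewise Morse coordinates from a global adapted frame -/

/-- **The fibrewise Morse lemma with a global adapted frame** (Morse–Bott lemma along the zero
section, trivialised form).  Let `g : P × V → ℝ` be `C^∞` (`V` a real normed space of finite
dimension `n`) with `g (p, 0) = 0` and `∂ᵤ g (p, 0) = 0` for all `p`.  Let `B₀` be a symmetric
nondegenerate bilinear form on `V` of negative index of inertia `σ`, and `M p`, `M⁻¹ p` mutually
inverse linear maps of `V`, `C^∞` in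
`p`, ADAPTED to the fibre Hessians: `∂ᵤ∂ᵤ g (p, 0) (a, b) = 2 B₀ (M p a, M p b)` for all `p`.
Then there are an open `W ⊇ P × {0}`, a `C^∞` map `y : W → ℝⁿ` and a linear isomorphism
`Λ : V ≅ ℝⁿ` (sorted Sylvester coordinates of `B₀`) with `y (p, 0) = 0`, `∂ᵤ y (p, 0) = Λ ∘ M p`
for EVERY `p`, and `g = -(y₀² + ⋯ + y_{σ-1}²) + (y_σ² + ⋯ + y_{n-1}²)` on `W`; and `W`, `y` are
invariant under every translation `p ↦ p + c` of the parameter leaving `g`, `M`, `M⁻¹` invariant.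
Proof:
Hirsch's, with the fibre Hadamard form `B` (`g (p, u) = B (p, u) (u, u)`, `B (p, 0) = ½ H(p)`)
replaced by the normalised form `B̂ (p, u) = B (p, u) ∘ (M⁻¹ p × M⁻¹ p)`, which equals `B₀` along
the whole zero section: `θ (p, u) = P(B̂ (p, u)) (M p u)`, `y = Λ ∘ θ`.
[cite: HirschDT1976, Ch. 6 §1, Thm. 1.1 (proof, pp. 145–146)]
[cite: BanyagaHurtubise2004, Thm. 2] -/
theorem exists_fibrewiseMorseCoords_of_frame {g : P × V → ℝ} (hg : ContDiff ℝ ∞ g)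
    (h0 : ∀ p, g (p, 0) = 0) (h1 : ∀ (p : P) (a : V), fderiv ℝ g (p, 0) ((0 : P), a) = 0)
    (B₀ : V →L[ℝ] V →L[ℝ] ℝ) (hB₀symm : ∀ u v, B₀ u v = B₀ v u)
    (hB₀nd : ∀ u, (∀ v, B₀ u v = 0) → u = 0) (hn : finrank ℝ V = n)
    {M Minv : P → (V →L[ℝ] V)} (hM : ContDiff ℝ ∞ M) (hMinv : ContDiff ℝ ∞ Minv)
    (hMM : ∀ (p : P) (a : V), M p (Minv p a) = a) (hMM' : ∀ (p : P) (a : V), Minv p (M p a) = a)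
    (hadapt : ∀ (p : P) (a b : V),
      fderiv ℝ (fderiv ℝ g) (p, 0) ((0 : P), a) ((0 : P), b) = 2 * B₀ (M p a) (M p b)) :
    ∃ (W : Set (P × V)) (y : P × V → EuclideanSpace ℝ (Fin n))
      (Λ : V ≃L[ℝ] EuclideanSpace ℝ (Fin n)),
      IsOpen W ∧ (∀ p : P, ((p, (0 : V)) : P × V) ∈ W) ∧ ContDiffOn ℝ ∞ y W ∧
      (∀ p : P, y (p, 0) = 0) ∧
      (∀ p : P, HasFDerivAt (fun u : V => y (p, u))
        ((Λ : V →L[ℝ] EuclideanSpace ℝ (Fin n)).comp (M p)) 0) ∧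
      (∀ v : V, B₀ v v =
        - ∑ i ∈ Finset.univ.filter (fun i : Fin n =>
              i.val < sigNeg ((B₀.toBilinForm).toQuadraticMap)), (Λ v i) ^ 2
        + ∑ i ∈ Finset.univ.filter (fun i : Fin n =>
              sigNeg ((B₀.toBilinForm).toQuadraticMap) ≤ i.val), (Λ v i) ^ 2) ∧
      (∀ q ∈ W, g q =
        - ∑ i ∈ Finset.univ.filter (fun i : Fin n =>
              i.val < sigNeg ((B₀.toBilinForm).toQuadraticMap)), (y q i) ^ 2
        + ∑ i ∈ Finset.univ.filter (fun i : Fin n =>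
              sigNeg ((B₀.toBilinForm).toQuadraticMap) ≤ i.val), (y q i) ^ 2) ∧
      ∀ c : P, (∀ (p : P) (u : V), g (p + c, u) = g (p, u)) → (∀ p, M (p + c) = M p) →
        (∀ p, Minv (p + c) = Minv p) →
        (∀ q : P × V, ((q.1 + c, q.2) : P × V) ∈ W ↔ q ∈ W) ∧
          ∀ q : P × V, y (q.1 + c, q.2) = y q := by
  have h2 : (2 : WithTop ℕ∞) ≤ ∞ := WithTop.coe_le_coe.2 le_top
  -- the fibre Hadamard form `B`: smooth, symmetric, `g (p, u) = B (p, u) u u`, `B (p, 0) = ½ H(p)`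
  set B : P × V → (V →L[ℝ] V →L[ℝ] ℝ) :=
    Literature.Analysis.Calculus.fibreHadamardSnd g with hB
  have hBs : ContDiff ℝ ∞ B := Literature.Analysis.Calculus.contDiff_fibreHadamardSnd hg
  have hBsymm : ∀ (q : P × V) (u v : V), B q u v = B q v u := fun q u v => by
    obtain ⟨p, w⟩ := q
    exact Literature.Analysis.Calculus.fibreHadamardSnd_symm hg h2 p w u v
  have hgB : ∀ q : P × V, g q = B q q.2 q.2 := fun q => by
    obtain ⟨p, u⟩ := q
    exact Literature.Analysis.Calculus.eq_fibreHadamardSnd_of_isCritical hg h2 (h0 p) (h1 p) u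
  have hB0 : ∀ (p : P) (a b : V), B (p, 0) a b = B₀ (M p a) (M p b) := fun p a b => by
    rw [hB, Literature.Analysis.Calculus.fibreHadamardSnd_apply_zero, hadapt, smul_eq_mul]
    ring
  -- the normalised form `B̂ (p, u) = B (p, u) ∘ (M⁻¹ p × M⁻¹ p)`
  set Bh : P × V → (V →L[ℝ] V →L[ℝ] ℝ) :=
    fun q => (B q).bilinearComp (Minv q.1) (Minv q.1) with hBh
  have hBh_apply : ∀ (q : P × V) (a b : V), Bh q a b = B q (Minv q.1 a) (Minv q.1 b) :=
    fun q a b => by simp [hBh]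
  have hMinva : ∀ a : V, ContDiff ℝ ∞ fun q : P × V => Minv q.1 a := fun a =>
    (hMinv.comp contDiff_fst).clm_apply contDiff_const
  have hBhs : ContDiff ℝ ∞ Bh := by
    refine contDiff_clm_apply_iff.2 fun a => contDiff_clm_apply_iff.2 fun b => ?_
    have : (fun q => Bh q a b) = fun q => B q (Minv q.1 a) (Minv q.1 b) :=
      funext fun q => hBh_apply q a b
    rw [this]
    exact (hBs.clm_apply (hMinva a)).clm_apply (hMinva b)
  have hBhsymm : ∀ (q : P × V) (u v : V), Bh q u v = Bh q v u := fun q u v => by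
    rw [hBh_apply, hBh_apply, hBsymm]
  have hBh0 : ∀ p : P, Bh (p, 0) = B₀ := fun p => by
    ext a b
    rw [hBh_apply, hB0, hMM, hMM]
  have hgBh : ∀ q : P × V, g q = Bh q (M q.1 q.2) (M q.1 q.2) := fun q => by
    rw [hgB q, hBh_apply, hMM']
  -- Hirsch's lemma at `B₀` and sorted Sylvester coordinates of `B₀`
  obtain ⟨N, Pm, hNo, hB₀N, hPs, hPB₀, hPeq⟩ := exists_contDiffOn_bilinearComp_eq B₀ hB₀symm hB₀nd
  obtain ⟨Λ, hΛ⟩ := exists_continuousLinearEquiv_eq_sum_sq B₀ hB₀symm hB₀nd hn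
  set W : Set (P × V) := Bh ⁻¹' N with hW
  have hWo : IsOpen W := hNo.preimage hBhs.continuous
  have hW₀ : ∀ p : P, ((p, (0 : V)) : P × V) ∈ W := fun p => by
    show Bh (p, 0) ∈ N
    rw [hBh0]
    exact hB₀N
  set θ : P × V → V := fun q => Pm (Bh q) (M q.1 q.2) with hθ
  set y : P × V → EuclideanSpace ℝ (Fin n) := fun q => Λ (θ q) with hy
  have hMq : ContDiff ℝ ∞ fun q : P × V => M q.1 q.2 :=
    (hM.comp contDiff_fst).clm_apply contDiff_snd
  have hPB : ContDiffOn ℝ ∞ (fun q => Pm (Bh q)) W := hPs.comp hBhs.contDiffOn fun q hq => hq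
  have hθs : ContDiffOn ℝ ∞ θ W := hPB.clm_apply hMq.contDiffOn
  have hys : ContDiffOn ℝ ∞ y W := Λ.contDiff.comp_contDiffOn hθs
  refine ⟨W, y, Λ, hWo, hW₀, hys, fun p => by simp [hy, hθ], fun p => ?_, hΛ, fun q hq => ?_,
    fun c hgc hMc hMinvc => ?_⟩
  · -- `∂ᵤ θ (p, 0) = P(B₀) ∘ M p = M p`, hence `∂ᵤ y (p, 0) = Λ ∘ M p`
    have hc : DifferentiableAt ℝ (fun u : V => Pm (Bh (p, u))) 0 := by
      have h : ContDiffAt ℝ ∞ (fun u : V => Pm (Bh (p, u))) 0 :=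
        (hPB.contDiffAt (hWo.mem_nhds (hW₀ p))).comp 0 (contDiff_prodMk_right p).contDiffAt
      exact h.differentiableAt (by simp)
    have hθd : HasFDerivAt (fun u : V => θ (p, u)) (M p) 0 := by
      have h := hc.hasFDerivAt.clm_apply ((M p).hasFDerivAt (x := (0 : V)))
      refine h.congr_fderiv ?_
      ext v
      simp [hBh0, hPB₀]
    have hyd := (Λ : V →L[ℝ] EuclideanSpace ℝ (Fin n)).hasFDerivAt.comp (0 : V) hθd
    exact hyd
  · -- `g q = B₀ (θ q) (θ q)` in the Sylvester coordinates
    have hqeq : g q = B₀ (θ q) (θ q) := by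
      rw [hgBh q]
      exact (hPeq (Bh q) hq (hBhsymm q) _ _).symm
    rw [hqeq, hΛ (θ q)]
  · -- invariance under translations of the parameter
    have hBc : ∀ q : P × V, B (q.1 + c, q.2) = B q := fun q =>
      Literature.Analysis.Calculus.fibreHadamardSnd_translate c hgc q.1 q.2
    have hBhc : ∀ q : P × V, Bh (q.1 + c, q.2) = Bh q := fun q => by
      ext a b
      rw [hBh_apply, hBh_apply, hBc, hMinvc]
    refine ⟨fun q => ?_, fun q => ?_⟩
    · show Bh (q.1 + c, q.2) ∈ N ↔ Bh q ∈ N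
      rw [hBhc]
    · simp only [hy, hθ, hBhc, hMc]

/-- **Periodic fibrewise Morse coordinates along a line of nondegenerate critical points**
(the form used along a circle).  Let `g : ℝ × V → ℝ` be `C^∞` and `T`-periodic in `t`, with
`g (t, 0) = 0`, `∂ᵤ g (t, 0) = 0`, and let `M t`, `M⁻¹ t` be a `C^∞`, `T`-periodic adapted frame
for the fibre Hessians with respect to a symmetric nondegenerate `B₀`
(`∂ᵤ∂ᵤ g (t, 0) (a, b) = 2 B₀ (M t a, M t b)`).  Then there are `r > 0`, a map `y`, `C^∞` on the
tube `ℝ × B(0, r)`, and Sylvester coordinates `Λ` of `B₀` with: `y (t + T, u) = y (t, u)`,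
`y (t, 0) = 0`, `∂ᵤ y (t, 0) = Λ ∘ M t`, and `g = -(y₀² + ⋯ + y_{σ-1}²) + (y_σ² + ⋯)` on the tube
(`exists_fibrewiseMorseCoords_of_frame` and `exists_ball_subset_of_forall_add`).
[cite: BanyagaHurtubise2004, Thm. 2] [cite: HirschDT1976, Ch. 6 §1] -/
theorem exists_periodic_fibrewiseMorseCoords_of_frame {g : ℝ × V → ℝ} (hg : ContDiff ℝ ∞ g)
    {T : ℝ} (hT : 0 < T) (hgT : ∀ (t : ℝ) (u : V), g (t + T, u) = g (t, u))
    (h0 : ∀ t, g (t, 0) = 0) (h1 : ∀ (t : ℝ) (a : V), fderiv ℝ g (t, 0) ((0 : ℝ), a) = 0)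
    (B₀ : V →L[ℝ] V →L[ℝ] ℝ) (hB₀symm : ∀ u v, B₀ u v = B₀ v u)
    (hB₀nd : ∀ u, (∀ v, B₀ u v = 0) → u = 0) (hn : finrank ℝ V = n)
    {M Minv : ℝ → (V →L[ℝ] V)} (hM : ContDiff ℝ ∞ M) (hMinv : ContDiff ℝ ∞ Minv)
    (hMT : ∀ t, M (t + T) = M t) (hMinvT : ∀ t, Minv (t + T) = Minv t)
    (hMM : ∀ (t : ℝ) (a : V), M t (Minv t a) = a) (hMM' : ∀ (t : ℝ) (a : V), Minv t (M t a) = a)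
    (hadapt : ∀ (t : ℝ) (a b : V),
      fderiv ℝ (fderiv ℝ g) (t, 0) ((0 : ℝ), a) ((0 : ℝ), b) = 2 * B₀ (M t a) (M t b)) :
    ∃ (r : ℝ) (y : ℝ × V → EuclideanSpace ℝ (Fin n)) (Λ : V ≃L[ℝ] EuclideanSpace ℝ (Fin n)), 0 < r ∧
      ContDiffOn ℝ ∞ y (univ ×ˢ ball (0 : V) r) ∧
      (∀ (t : ℝ) (u : V), y (t + T, u) = y (t, u)) ∧
      (∀ t : ℝ, y (t, 0) = 0) ∧
      (∀ t : ℝ, HasFDerivAt (fun u : V => y (t, u))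
        ((Λ : V →L[ℝ] EuclideanSpace ℝ (Fin n)).comp (M t)) 0) ∧
      (∀ v : V, B₀ v v =
        - ∑ i ∈ Finset.univ.filter (fun i : Fin n =>
              i.val < sigNeg ((B₀.toBilinForm).toQuadraticMap)), (Λ v i) ^ 2
        + ∑ i ∈ Finset.univ.filter (fun i : Fin n =>
              sigNeg ((B₀.toBilinForm).toQuadraticMap) ≤ i.val), (Λ v i) ^ 2) ∧
      ∀ (t : ℝ) (u : V), u ∈ ball (0 : V) r → g (t, u) =
        - ∑ i ∈ Finset.univ.filter (fun i : Fin n =>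
              i.val < sigNeg ((B₀.toBilinForm).toQuadraticMap)), (y (t, u) i) ^ 2
        + ∑ i ∈ Finset.univ.filter (fun i : Fin n =>
              sigNeg ((B₀.toBilinForm).toQuadraticMap) ≤ i.val), (y (t, u) i) ^ 2 := by
  obtain ⟨W, y, Λ, hWo, hW₀, hys, hy0, hyd, hΛ, hgy, hinv⟩ :=
    exists_fibrewiseMorseCoords_of_frame hg h0 h1 B₀ hB₀symm hB₀nd hn hM hMinv hMM hMM' hadapt
  obtain ⟨hWT, hyT⟩ := hinv T hgT hMT hMinvT
  have hWT' : ∀ (t : ℝ) (u : V), ((t, u) : ℝ × V) ∈ W → ((t - T, u) : ℝ × V) ∈ W :=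
    fun t u h => by
      have := (hWT (t - T, u)).2
      rw [sub_add_cancel] at this
      exact (hWT (t - T, u)).1 (by simpa using h)
  obtain ⟨r, hr, hball⟩ := exists_ball_subset_of_forall_add hWo hW₀ hT
    (fun t u h => (hWT (t, u)).2 h) hWT'
  refine ⟨r, y, Λ, hr, hys.mono ?_, fun t u => hyT (t, u), hy0, hyd, hΛ,
    fun t u hu => hgy _ (hball t u hu)⟩
  rintro ⟨t, u⟩ ⟨-, hu⟩
  exact hball t u hu

end Splitting

end Literature.Topology.FourManifolds
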